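import Summits.BirchSwinnertonDyer.BirchSwinnertonDyer.Theorems.KatoDescentTamePotSupersingularTameLowerFouquetRoadTate
import Literature.NumberTheory.EllipticCurves.Fouquet2025.CongruenceTransportFromBCSSeedProofs
import Literature.NumberTheory.EllipticCurves.KrausOesterle1992.TraceCongruenceOfTorsionIsoProofs
import Literature.NumberTheory.EllipticCurves.AnalyticRankModularityProofs
import HarnessLib

/-!
# Route `KatoDescentTamePotSupersingular` (rung K8-t′, cell `bsd-potss`): the THIRD seed road `SeedRowC` — L₀ and
# `BSD_p` on the (t′) rank-0 rows at `p ≥ 5` carrying a congruent good-ordinary partner with big `p`-adic image,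
# from Fouquet 2025 Thm 4.1 (1)⇒(2) with the seed's main-conjecture identity supplied by
# Burungale–Castella–Skinner 2025 Thm 1.1.2 (b) (a `--supports … --as helper` file; items 19618
# `TameLowerIntrinsicNonCM` / 19981 `TameLowerHalfRankZero`; seat `bsd-potss-k8t-c2`, generation 9)

WHY THIS FILE. The two seed roads of the 19618 skeleton v5 (`SeedRowA` / `SeedRowB`, this seat's
`…TameLowerFouquetRoadTate.lean`, p462359) display the seed `G` by `GoodOrd ∧ Surj ∧ Ram ∧ …`: the ramified
multiplicative prime `Ram G p` is the hypothesis of Skinner–Urban 2014 Thm 3.6.9, the supplier of Kato's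
Conj. 12.10 for `(G, p)` in Kato's §17.13 reading. The typing layer (bsd-littype-07 g3, p474356,
`Literature/…/Fouquet2025/CongruenceTransportFromBCSSeedProofs.lean`, THEOREMS ONLY) re-routed that input to the
REFEREED Burungale–Castella–Skinner 2025 Thm 1.1.2 (b) (`burungale_castella_skinner_charIdeal_eq_padicLFunction_integral`,
IMRN 2025): for `G` good ordinary at `p ≥ 5` with `ρ_{G,p^n}` onto for all `n`, the integral cyclotomic main
identity holds WITHOUT a ramified Steinberg prime and WITHOUT any rank / `L`-value condition on `G`. The
planner adopted the road at evidence level as `SeedRowC` (plan g18, HOME/INBOX 2026-08-27T00:16:44Z (4):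
"rows only, skeleton unchanged"). This file is the route-side road over it, in the shapes of `…FouquetRoadTate`:

* §1 per pair, strict `Σ` (level-compatible partner, fact (A′)
  `Fouquet2025.padicValRat_bsd_rank_zero_of_congruence_of_seedMainIdentity`): the print shape `PPartRankZero W p`,
  Miller's `BSDp W p`, both typed halves `MissingPPartAt W p` and the crux currency `MissingLowerBoundAt W p`,
  for `W` with `ρ̄_{W,p}` onto, Ass. 2.9 (2) exact (`FouquetGenericAt`), Ass. 3.4 in Tate form
  (`Fouquet2025.Assumption34TateAt`), and a partner `G` displayed by `GoodOrd G p ∧ Surj G p`, the congruence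
  `IsCongruentModP p W G` and `FouquetLevelCompatibleAt p W G` (the tower surjectivity of `G` DERIVED from
  `Surj G p` at `p ≥ 5` by Serre's lemma `serre_hasSurjectiveModNGaloisRep_pow_holds`; modularity
  `exists_isNewformOf` names the partner's newform and gives `hasEntireLFunction_rat`);
* §2 the same over the enlarged `Σ = primes(p·N_W·N_G)` (fact (A′σ) `…_of_seedMainIdentity_sigma`;
  `Assumption34TateAt p G` instead of the level binder);
* §3 the ROW FORMS `SeedRowC` (strict / `Σ`) for the census — L₀ / `MissingPPartAt` on every (t′) rank-`0` row at
  `p ≥ 5` with `Surj W p`, `FouquetGenericAt p W`, `Assumption34TateAt p W` and a seed displayed by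
  `GoodOrd ∧ Surj ∧ IsCongruentModP ∧ FouquetLevelCompatibleAt` (resp. `∧ Assumption34TateAt p G`) — NO `Ram`;
* §4 the CERTIFICATE CURRENCY of the per-row records: the congruence binder replaced by the named fact
  `KrausOesterle1992.prop4_torsionIso_of_congruences` (Kraus–Oesterlé 1992 Prop. 4, (ii) ⇒ (i), irreducible
  case; bib `KrausOesterle1992`) and its FINITE list of trace congruences below `μ(M)/6`
  (`KrausOesterle1992.lFunction_congr_of_prop4`), `W[p]` irreducible from `Surj W p`.

CENSUS (this seat, HOME/k8t-c2/g9/): on the 90 CONTENT rows (`5 ∣ #Ш_an`) of the cell `L_{II*,5}` (`p = 5`,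
Kodaira II*, `v₅(c₄) = 4`), 57 carry a congruent Cremona curve at `N_W/25` (plan g16 UNITSEED-content-congruentG.tsv),
ALL of rank `2` (the cell's visibility pattern), good ORDINARY at `5` with surjective `ρ̄_{G,5}`: 54 of them are
the S–U seeds of record (tier A 32 / tier B 22) and 3 rows (264600fz1, 270400hx1, 270400ip1, no ramified Steinberg
prime on `W`) ENTER L₀ coverage by this road. Per-row records: `…TameLowerSeedRowCRecords*.lean`.

HONEST FRAMING. Conditional on two cite-level facts taken as hypotheses — (A′) / (A′σ) (Fouquet 2025 Thm 4.1,
refereed; on the rows with `a_p(G)² ≡ 1 (mod p)` its Thm 2.10 input is the Colmez–Wang PREPRINT, flag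
`@Fouquet-2.10-via-ColmezWang-PRE`, recorded per row in the census) and BCS Thm 1.1.2 (b) (refereed; Wan's
three-variable divisibility inside) — plus modularity, GZK and, in §4, Kraus–Oesterlé Prop. 4. Items 19618 /
19981 are NOT closed (their class statement — Kato's Conj. 12.10 lower inclusion at an additive potentially
supersingular prime — is open off the seed rows); nothing is booked; BSD is not proved by any of this.

References: [Fouquet2025EquivariantTNC] Thm 4.1 (pp. 24–25), Thm 1.7 (2) (p. 7), remark before Cor. 4.3 (p. 25),
Ass. 2.9 (p. 15), Ass. 3.4 (pp. 22–23); [BurungaleCastellaSkinner2025] Thm 1.1.2 (b); [KrausOesterle1992] Prop. 4;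
[SerreAbelianLadic1968] Ch. IV §3.4 Lemma 3; [Kato2004Asterisque] Conj. 12.10 (p. 224), §17.13; [Miller2011LMS] Def. 1.1;
[DiamondShurman2005] Thm. 8.8.3.
-/

set_option autoImplicit false
-- sibling precedent (`KatoDescentTamePotSupersingularTameLowerFouquetRoadTate.lean`): the directory name repeats the summit name
set_option linter.dupNamespace false

noncomputable section

open scoped Classical

namespace Summit.BirchSwinnertonDyer.BirchSwinnertonDyer.Theorems

open WeierstrassCurve Literature.NumberTheory.EllipticCurves
  Literature.NumberTheory.EllipticCurves.ModularForms
  Literature.NumberTheory.EllipticCurves.Rank1Residual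
  Literature.NumberTheory.EllipticCurves.Rank1Residual.Typed
  Summit.BirchSwinnertonDyer.Rank1Residual.Additive
  Summit.BirchSwinnertonDyer.Rank1Residual
  Summit.BirchSwinnertonDyer.BirchSwinnertonDyer.Theses.KatoDescentTamePotSupersingular

/-! ## §1 Per pair, strict `Σ` (level-compatible partner): (A′) + BCS Thm 1.1.2 (b) -/

section StrictPerPair

variable (W G : WeierstrassCurve ℚ) [W.IsElliptic] [W.IsGloballyMinimal] [G.IsElliptic] [G.IsGloballyMinimal]
  (p : ℕ) [Fact p.Prime]

/-- **Bridge (definitional): the BCS-seed turnkey's binders are the route's census predicates unfolded, its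
conclusion is `PPartRankZero W p` unfolded.** For `W` of ANY reduction type at `p ≥ 5` with `ρ̄_{W,p}` onto,
Ass. 2.9 (2) exact (`FouquetGenericAt`), Ass. 3.4 in Tate form, and a level-compatible congruent partner `G`
good ordinary at `p` with `ρ̄_{G,p}` onto (tower onto by Serre's lemma), `L(W,1) ≠ 0` and `Ш(W)` finite:
the print shape of the `p`-part of BSD in rank `0`. NO `Ram`, rank or `L`-value condition on `G`.
Conditional on (A′) `hA`, BCS `hBCS`, modularity `hmodN`; nothing credited.
[cite: Fouquet2025EquivariantTNC, Thm 4.1 (1)⇒(2) (pp. 24–25) and Thm 1.7 (2) (p. 7)]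
[cite: BurungaleCastellaSkinner2025, Thm 1.1.2 (b)] [cite: SerreAbelianLadic1968, Ch. IV §3.4 Lemma 3] -/
theorem pPartRankZero_of_bcsSeed
    (hA : Fouquet2025.padicValRat_bsd_rank_zero_of_congruence_of_seedMainIdentity)
    (hBCS : burungale_castella_skinner_charIdeal_eq_padicLFunction_integral) (hmodN : exists_isNewformOf)
    (hp : 5 ≤ p) (hsurj : Surj W p) (hgen : FouquetGenericAt p W) (h34 : Fouquet2025.Assumption34TateAt p W)
    (hord : GoodOrd G p) (hsurjG : Surj G p) (hcong : IsCongruentModP p W G)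
    (hlev : FouquetLevelCompatibleAt p W G) (hL : W.entireLFunction 1 ≠ 0) (hfin : Finite W.sha) :
    PPartRankZero W p :=
  Fouquet2025.padicValRat_bsd_rank_zero_of_congruence_of_bcsSeed hA hBCS hmodN W G p hp hsurj hgen h34 hord.1
    hord.2 (serre_hasSurjectiveModNGaloisRep_pow_holds G p hp hsurjG) hcong hlev hL hfin

/-- **Miller's `BSD(W,p)` on a rank-`0` row at `p ≥ 5` with a congruent good-ordinary BCS seed** — from (A′) +
BCS + modularity (`L(W,1) = L^{(0)}(W,1) ≠ 0`) + Gross–Zagier–Kolyvagin (`Ш` finite, rank `0`), via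
`bsdp_of_pPartRankZero`. Conditional; nothing credited.
[cite: Fouquet2025EquivariantTNC, Thm 1.7 (2) (p. 7)] [cite: BurungaleCastellaSkinner2025, Thm 1.1.2 (b)]
[cite: Miller2011LMS, Def. 1.1] -/
theorem bsdp_rankZero_of_bcsSeed
    (hA : Fouquet2025.padicValRat_bsd_rank_zero_of_congruence_of_seedMainIdentity)
    (hBCS : burungale_castella_skinner_charIdeal_eq_padicLFunction_integral) (hmodN : exists_isNewformOf)
    (hGZK : rank_eq_analyticRank_of_analyticRank_le_one) (hp : 5 ≤ p) (hr : W.analyticRank = 0)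
    (hsurj : Surj W p) (hgen : FouquetGenericAt p W) (h34 : Fouquet2025.Assumption34TateAt p W)
    (hord : GoodOrd G p) (hsurjG : Surj G p) (hcong : IsCongruentModP p W G)
    (hlev : FouquetLevelCompatibleAt p W G) : BSDp W p := by
  have hmod : hasEntireLFunction_rat := hasEntireLFunction_rat_of_exists_isNewformOf hmodN
  have hfin : Finite W.sha := (hGZK W (by omega)).2
  have hL : W.entireLFunction 1 ≠ 0 := by
    rw [← W.leadingLCoeff_eq_of_analyticRank_eq_zero hr]
    exact W.leadingLCoeff_ne_zero_holds (hmod W)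
  exact bsdp_of_pPartRankZero W p hmod hGZK hr
    (pPartRankZero_of_bcsSeed W G p hA hBCS hmodN hp hsurj hgen h34 hord hsurjG hcong hlev hL hfin)

/-- **`MissingPPartAt W p` — BOTH halves — on a rank-`0` row at `p ≥ 5` with a congruent good-ordinary BCS seed,
strict `Σ`.** Conditional on (A′) + BCS + modularity + GZK; nothing credited.
[cite: Fouquet2025EquivariantTNC, Thm 1.7 (2) (p. 7)] [cite: BurungaleCastellaSkinner2025, Thm 1.1.2 (b)]
[cite: Miller2011LMS, Def. 1.1] -/
theorem missingPPartAt_rankZero_of_bcsSeed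
    (hA : Fouquet2025.padicValRat_bsd_rank_zero_of_congruence_of_seedMainIdentity)
    (hBCS : burungale_castella_skinner_charIdeal_eq_padicLFunction_integral) (hmodN : exists_isNewformOf)
    (hGZK : rank_eq_analyticRank_of_analyticRank_le_one) (hp : 5 ≤ p) (hr : W.analyticRank = 0)
    (hsurj : Surj W p) (hgen : FouquetGenericAt p W) (h34 : Fouquet2025.Assumption34TateAt p W)
    (hord : GoodOrd G p) (hsurjG : Surj G p) (hcong : IsCongruentModP p W G)
    (hlev : FouquetLevelCompatibleAt p W G) : MissingPPartAt W p := by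
  haveI : Finite W.sha := (hGZK W (by omega)).2
  exact missingPPartAt_of_bsdp W p
    (bsdp_rankZero_of_bcsSeed W G p hA hBCS hmodN hGZK hp hr hsurj hgen h34 hord hsurjG hcong hlev)

/-- **The crux's currency `MissingLowerBoundAt W p` (L₀ = `ord_p #Ш_an ≤ ord_p #Ш`) on a rank-`0` row at `p ≥ 5`
with a congruent good-ordinary BCS seed, strict `Σ`.** Conditional; the items are NOT closed.
[cite: Fouquet2025EquivariantTNC, Thm 4.1 (pp. 24–25)] [cite: BurungaleCastellaSkinner2025, Thm 1.1.2 (b)]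
[cite: Miller2011LMS, Def. 1.1] -/
theorem missingLowerBoundAt_rankZero_of_bcsSeed
    (hA : Fouquet2025.padicValRat_bsd_rank_zero_of_congruence_of_seedMainIdentity)
    (hBCS : burungale_castella_skinner_charIdeal_eq_padicLFunction_integral) (hmodN : exists_isNewformOf)
    (hGZK : rank_eq_analyticRank_of_analyticRank_le_one) (hp : 5 ≤ p) (hr : W.analyticRank = 0)
    (hsurj : Surj W p) (hgen : FouquetGenericAt p W) (h34 : Fouquet2025.Assumption34TateAt p W)
    (hord : GoodOrd G p) (hsurjG : Surj G p) (hcong : IsCongruentModP p W G)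
    (hlev : FouquetLevelCompatibleAt p W G) : MissingLowerBoundAt W p :=
  (lower_and_upper_of_missingPPartAt W p
    (missingPPartAt_rankZero_of_bcsSeed W G p hA hBCS hmodN hGZK hp hr hsurj hgen h34 hord hsurjG hcong hlev)).1

end StrictPerPair

/-! ## §2 Per pair over `Σ = primes(p·N_W·N_G)` (level-raised partners): (A′σ) + BCS Thm 1.1.2 (b) -/

section SigmaPerPair

variable (W G : WeierstrassCurve ℚ) [W.IsElliptic] [W.IsGloballyMinimal] [G.IsElliptic] [G.IsGloballyMinimal]
  (p : ℕ) [Fact p.Prime]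

/-- **Bridge (definitional), enlarged `Σ`**: as `pPartRankZero_of_bcsSeed` with the level binder replaced by
`Assumption34TateAt p G` (Ass. 3.4 in Tate form on the partner's unramified Steinberg primes) and the fact by (A′σ).
Conditional; nothing credited. [cite: Fouquet2025EquivariantTNC, Thm 4.1 (1)⇒(2), Thm 1.7 (2), Ass. 3.4 (pp. 22–23)]
[cite: BurungaleCastellaSkinner2025, Thm 1.1.2 (b)] [cite: SerreAbelianLadic1968, Ch. IV §3.4 Lemma 3] -/
theorem pPartRankZero_of_bcsSeedSigma
    (hA : Fouquet2025.padicValRat_bsd_rank_zero_of_congruence_of_seedMainIdentity_sigma)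
    (hBCS : burungale_castella_skinner_charIdeal_eq_padicLFunction_integral) (hmodN : exists_isNewformOf)
    (hp : 5 ≤ p) (hsurj : Surj W p) (hgen : FouquetGenericAt p W) (h34 : Fouquet2025.Assumption34TateAt p W)
    (hord : GoodOrd G p) (hsurjG : Surj G p) (hcong : IsCongruentModP p W G)
    (h34G : Fouquet2025.Assumption34TateAt p G) (hL : W.entireLFunction 1 ≠ 0) (hfin : Finite W.sha) :
    PPartRankZero W p :=
  Fouquet2025.padicValRat_bsd_rank_zero_of_congruence_of_bcsSeed_sigma hA hBCS hmodN W G p hp hsurj hgen h34 h34G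
    hord.1 hord.2 (serre_hasSurjectiveModNGaloisRep_pow_holds G p hp hsurjG) hcong hL hfin

/-- **`MissingPPartAt W p` on a rank-`0` row at `p ≥ 5` with a congruent good-ordinary BCS seed, enlarged `Σ`**
(level-raised partners with `Assumption34TateAt p G`). Conditional on (A′σ) + BCS + modularity + GZK; nothing credited.
[cite: Fouquet2025EquivariantTNC, Thm 1.7 (2) (p. 7), Ass. 3.4 (pp. 22–23)] [cite: BurungaleCastellaSkinner2025, Thm 1.1.2 (b)]
[cite: Miller2011LMS, Def. 1.1] -/
theorem missingPPartAt_rankZero_of_bcsSeedSigma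
    (hA : Fouquet2025.padicValRat_bsd_rank_zero_of_congruence_of_seedMainIdentity_sigma)
    (hBCS : burungale_castella_skinner_charIdeal_eq_padicLFunction_integral) (hmodN : exists_isNewformOf)
    (hGZK : rank_eq_analyticRank_of_analyticRank_le_one) (hp : 5 ≤ p) (hr : W.analyticRank = 0)
    (hsurj : Surj W p) (hgen : FouquetGenericAt p W) (h34 : Fouquet2025.Assumption34TateAt p W)
    (hord : GoodOrd G p) (hsurjG : Surj G p) (hcong : IsCongruentModP p W G)
    (h34G : Fouquet2025.Assumption34TateAt p G) : MissingPPartAt W p := by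
  have hmod : hasEntireLFunction_rat := hasEntireLFunction_rat_of_exists_isNewformOf hmodN
  have hfin : Finite W.sha := (hGZK W (by omega)).2
  have hL : W.entireLFunction 1 ≠ 0 := by
    rw [← W.leadingLCoeff_eq_of_analyticRank_eq_zero hr]
    exact W.leadingLCoeff_ne_zero_holds (hmod W)
  haveI := hfin
  exact missingPPartAt_of_bsdp W p
    (bsdp_of_pPartRankZero W p hmod hGZK hr
      (pPartRankZero_of_bcsSeedSigma W G p hA hBCS hmodN hp hsurj hgen h34 hord hsurjG hcong h34G hL hfin))

/-- **`MissingLowerBoundAt W p` on a rank-`0` row at `p ≥ 5` with a congruent good-ordinary BCS seed, enlarged `Σ`.**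
Conditional; the items are NOT closed. [cite: Fouquet2025EquivariantTNC, Thm 4.1 (pp. 24–25), Ass. 3.4 (pp. 22–23)]
[cite: BurungaleCastellaSkinner2025, Thm 1.1.2 (b)] [cite: Miller2011LMS, Def. 1.1] -/
theorem missingLowerBoundAt_rankZero_of_bcsSeedSigma
    (hA : Fouquet2025.padicValRat_bsd_rank_zero_of_congruence_of_seedMainIdentity_sigma)
    (hBCS : burungale_castella_skinner_charIdeal_eq_padicLFunction_integral) (hmodN : exists_isNewformOf)
    (hGZK : rank_eq_analyticRank_of_analyticRank_le_one) (hp : 5 ≤ p) (hr : W.analyticRank = 0)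
    (hsurj : Surj W p) (hgen : FouquetGenericAt p W) (h34 : Fouquet2025.Assumption34TateAt p W)
    (hord : GoodOrd G p) (hsurjG : Surj G p) (hcong : IsCongruentModP p W G)
    (h34G : Fouquet2025.Assumption34TateAt p G) : MissingLowerBoundAt W p :=
  (lower_and_upper_of_missingPPartAt W p
    (missingPPartAt_rankZero_of_bcsSeedSigma W G p hA hBCS hmodN hGZK hp hr hsurj hgen h34 hord hsurjG hcong h34G)).1

end SigmaPerPair

/-! ## §3 Row forms `SeedRowC` for the census (seed displayed by `GoodOrd ∧ Surj` + congruence + level / Ass. 3.4) -/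

/-- **SeedRowC (strict): L₀ on every (t′) rank-`0` row at `p ≥ 5` with `ρ̄` onto, Ass. 2.9 (2) exact, Ass. 3.4 in
Tate form, and a level-compatible congruent good-ordinary partner displayed by `GoodOrd ∧ Surj` — NO `Ram`, NO rank
or `L`-value condition** (the third seed-row kind of the 19618 census; `SeedRowB W p` without its `Ram G p` conjunct
and with the level binder implies it). The (t′) binders `Addv` / `SubTprime` are carried for the item's shape and
are idle (the facts are reduction-free). Conditional on (A′) `hA` + BCS `hBCS` + modularity + GZK; nothing credited;
items NOT closed. [cite: Fouquet2025EquivariantTNC, Thm 4.1 and Thm 1.7 (2)] [cite: BurungaleCastellaSkinner2025, Thm 1.1.2 (b)]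
[cite: SerreAbelianLadic1968, Ch. IV §3.4 Lemma 3] [cite: Miller2011LMS, Def. 1.1] -/
theorem tameLowerHalf_fouquetSeedRowsC_of_bcsSeedFacts
    (hA : Fouquet2025.padicValRat_bsd_rank_zero_of_congruence_of_seedMainIdentity)
    (hBCS : burungale_castella_skinner_charIdeal_eq_padicLFunction_integral) (hmodN : exists_isNewformOf)
    (hGZK : rank_eq_analyticRank_of_analyticRank_le_one) :
    ∀ (W : WeierstrassCurve ℚ) [W.IsElliptic] [W.IsGloballyMinimal] (p : ℕ) [Fact p.Prime],
      W.analyticRank = 0 → 5 ≤ p → Addv W p → SubTprime W p → Surj W p → FouquetGenericAt p W →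
      Fouquet2025.Assumption34TateAt p W →
      (∃ (G : WeierstrassCurve ℚ) (_ : G.IsElliptic) (_ : G.IsGloballyMinimal),
        GoodOrd G p ∧ Surj G p ∧ IsCongruentModP p W G ∧ FouquetLevelCompatibleAt p W G) →
      MissingLowerBoundAt W p := by
  intro W _ _ p _ hr hp _ _ hsurj hgen h34 hseed
  obtain ⟨G, hGe, hGm, hord, hsurjG, hcong, hlev⟩ := hseed
  exact missingLowerBoundAt_rankZero_of_bcsSeed W G p hA hBCS hmodN hGZK hp hr hsurj hgen h34 hord hsurjG hcong hlev

/-- **Both halves (`MissingPPartAt`) on the same rows (SeedRowC strict)** — the form the U₀ side may consume.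
Conditional; nothing credited. [cite: Fouquet2025EquivariantTNC, Thm 1.7 (2) (p. 7)] [cite: BurungaleCastellaSkinner2025, Thm 1.1.2 (b)]
[cite: Miller2011LMS, Def. 1.1] -/
theorem tameMissingPPartAt_fouquetSeedRowsC_of_bcsSeedFacts
    (hA : Fouquet2025.padicValRat_bsd_rank_zero_of_congruence_of_seedMainIdentity)
    (hBCS : burungale_castella_skinner_charIdeal_eq_padicLFunction_integral) (hmodN : exists_isNewformOf)
    (hGZK : rank_eq_analyticRank_of_analyticRank_le_one) :
    ∀ (W : WeierstrassCurve ℚ) [W.IsElliptic] [W.IsGloballyMinimal] (p : ℕ) [Fact p.Prime],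
      W.analyticRank = 0 → 5 ≤ p → Addv W p → SubTprime W p → Surj W p → FouquetGenericAt p W →
      Fouquet2025.Assumption34TateAt p W →
      (∃ (G : WeierstrassCurve ℚ) (_ : G.IsElliptic) (_ : G.IsGloballyMinimal),
        GoodOrd G p ∧ Surj G p ∧ IsCongruentModP p W G ∧ FouquetLevelCompatibleAt p W G) →
      MissingPPartAt W p := by
  intro W _ _ p _ hr hp _ _ hsurj hgen h34 hseed
  obtain ⟨G, hGe, hGm, hord, hsurjG, hcong, hlev⟩ := hseed
  exact missingPPartAt_rankZero_of_bcsSeed W G p hA hBCS hmodN hGZK hp hr hsurj hgen h34 hord hsurjG hcong hlev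

/-- **SeedRowC (`Σ`-form): L₀ on every (t′) rank-`0` row at `p ≥ 5` with `ρ̄` onto, Ass. 2.9 (2) exact, Ass. 3.4 in
Tate form, and a congruent good-ordinary partner displayed by `GoodOrd ∧ Surj ∧ IsCongruentModP ∧ Assumption34TateAt p G`
(level-raising partners allowed) — NO `Ram`.** Conditional on (A′σ) + BCS + modularity + GZK; nothing credited; items NOT closed.
[cite: Fouquet2025EquivariantTNC, Thm 4.1 and Thm 1.7 (2), Ass. 3.4 (pp. 22–23)] [cite: BurungaleCastellaSkinner2025, Thm 1.1.2 (b)]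
[cite: Miller2011LMS, Def. 1.1] -/
theorem tameLowerHalf_fouquetSeedRowsC_of_bcsSeedSigmaFacts
    (hA : Fouquet2025.padicValRat_bsd_rank_zero_of_congruence_of_seedMainIdentity_sigma)
    (hBCS : burungale_castella_skinner_charIdeal_eq_padicLFunction_integral) (hmodN : exists_isNewformOf)
    (hGZK : rank_eq_analyticRank_of_analyticRank_le_one) :
    ∀ (W : WeierstrassCurve ℚ) [W.IsElliptic] [W.IsGloballyMinimal] (p : ℕ) [Fact p.Prime],
      W.analyticRank = 0 → 5 ≤ p → Addv W p → SubTprime W p → Surj W p → FouquetGenericAt p W →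
      Fouquet2025.Assumption34TateAt p W →
      (∃ (G : WeierstrassCurve ℚ) (_ : G.IsElliptic) (_ : G.IsGloballyMinimal),
        GoodOrd G p ∧ Surj G p ∧ IsCongruentModP p W G ∧ Fouquet2025.Assumption34TateAt p G) →
      MissingLowerBoundAt W p := by
  intro W _ _ p _ hr hp _ _ hsurj hgen h34 hseed
  obtain ⟨G, hGe, hGm, hord, hsurjG, hcong, h34G⟩ := hseed
  exact missingLowerBoundAt_rankZero_of_bcsSeedSigma W G p hA hBCS hmodN hGZK hp hr hsurj hgen h34 hord hsurjG hcong
    h34G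

/-- **Both halves (`MissingPPartAt`) on the same rows (SeedRowC `Σ`-form).** Conditional; nothing credited.
[cite: Fouquet2025EquivariantTNC, Thm 1.7 (2) (p. 7)] [cite: BurungaleCastellaSkinner2025, Thm 1.1.2 (b)]
[cite: Miller2011LMS, Def. 1.1] -/
theorem tameMissingPPartAt_fouquetSeedRowsC_of_bcsSeedSigmaFacts
    (hA : Fouquet2025.padicValRat_bsd_rank_zero_of_congruence_of_seedMainIdentity_sigma)
    (hBCS : burungale_castella_skinner_charIdeal_eq_padicLFunction_integral) (hmodN : exists_isNewformOf)
    (hGZK : rank_eq_analyticRank_of_analyticRank_le_one) :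
    ∀ (W : WeierstrassCurve ℚ) [W.IsElliptic] [W.IsGloballyMinimal] (p : ℕ) [Fact p.Prime],
      W.analyticRank = 0 → 5 ≤ p → Addv W p → SubTprime W p → Surj W p → FouquetGenericAt p W →
      Fouquet2025.Assumption34TateAt p W →
      (∃ (G : WeierstrassCurve ℚ) (_ : G.IsElliptic) (_ : G.IsGloballyMinimal),
        GoodOrd G p ∧ Surj G p ∧ IsCongruentModP p W G ∧ Fouquet2025.Assumption34TateAt p G) →
      MissingPPartAt W p := by
  intro W _ _ p _ hr hp _ _ hsurj hgen h34 hseed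
  obtain ⟨G, hGe, hGm, hord, hsurjG, hcong, h34G⟩ := hseed
  exact missingPPartAt_rankZero_of_bcsSeedSigma W G p hA hBCS hmodN hGZK hp hr hsurj hgen h34 hord hsurjG hcong h34G

/-! ## §4 Certificate currency: the congruence from Kraus–Oesterlé's FINITE criterion (named fact + finite list) -/

section Certificate

variable (W G : WeierstrassCurve ℚ) [W.IsElliptic] [W.IsGloballyMinimal] [G.IsElliptic] [G.IsGloballyMinimal]
  (p : ℕ) [Fact p.Prime]

/-- **`IsCongruentModP p W G` from Kraus–Oesterlé 1992 Prop. 4** (named fact `hKO`, (ii) ⇒ (i), irreducible case)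
and the FINITE list of trace congruences below `μ(M)/6` (`hlist`, per pair a kit certificate), `W[p]` irreducible
from `Surj W p`: the route's congruence predicate for EVERY prime `ℓ ∤ p N_W N_G`
(`KrausOesterle1992.lFunction_congr_of_prop4`). [cite: KrausOesterle1992, Prop. 4] -/
theorem isCongruentModP_of_prop4 (hKO : KrausOesterle1992.prop4_torsionIso_of_congruences) (hsurj : Surj W p)
    (hlist : ∀ (ℓ : ℕ) [Fact ℓ.Prime],
      6 * ℓ < KrausOesterle1992.gammaZeroIndex (KrausOesterle1992.modulus W G) →
      (padicValNat ℓ (W.conductorNorm ℤ * G.conductorNorm ℤ) = 0 →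
          (p : ℤ) ∣ W.frobeniusTrace ℓ - G.frobeniusTrace ℓ) ∧
        (padicValNat ℓ (W.conductorNorm ℤ * G.conductorNorm ℤ) = 1 →
          (p : ℤ) ∣ W.frobeniusTrace ℓ * G.frobeniusTrace ℓ - (ℓ + 1))) :
    IsCongruentModP p W G :=
  KrausOesterle1992.lFunction_congr_of_prop4 hKO W G p
    (hasIrreducibleModPGaloisRep_of_hasSurjectiveModNGaloisRep W p hsurj) hlist

/-- **The record shape (strict `Σ`): `MissingLowerBoundAt W p` on a rank-`0` row at `p ≥ 5` from a level-compatible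
congruent good-ordinary BCS seed, the congruence by Kraus–Oesterlé's finite criterion.** Hypotheses = named facts
(A′), BCS, modularity, GZK, K–O Prop. 4 + per pair: `r_an(W) = 0`, `Surj W p`, `FouquetGenericAt p W`,
`Assumption34TateAt p W`, `GoodOrd G p`, `Surj G p`, `FouquetLevelCompatibleAt p W G`, the finite K–O list.
Conditional; nothing credited; items NOT closed. [cite: Fouquet2025EquivariantTNC, Thm 4.1 (pp. 24–25)]
[cite: BurungaleCastellaSkinner2025, Thm 1.1.2 (b)] [cite: KrausOesterle1992, Prop. 4] [cite: Miller2011LMS, Def. 1.1] -/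
theorem missingLowerBoundAt_rankZero_of_bcsSeed_of_prop4
    (hA : Fouquet2025.padicValRat_bsd_rank_zero_of_congruence_of_seedMainIdentity)
    (hBCS : burungale_castella_skinner_charIdeal_eq_padicLFunction_integral) (hmodN : exists_isNewformOf)
    (hGZK : rank_eq_analyticRank_of_analyticRank_le_one) (hKO : KrausOesterle1992.prop4_torsionIso_of_congruences)
    (hp : 5 ≤ p) (hr : W.analyticRank = 0) (hsurj : Surj W p) (hgen : FouquetGenericAt p W)
    (h34 : Fouquet2025.Assumption34TateAt p W) (hord : GoodOrd G p) (hsurjG : Surj G p)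
    (hlev : FouquetLevelCompatibleAt p W G)
    (hlist : ∀ (ℓ : ℕ) [Fact ℓ.Prime],
      6 * ℓ < KrausOesterle1992.gammaZeroIndex (KrausOesterle1992.modulus W G) →
      (padicValNat ℓ (W.conductorNorm ℤ * G.conductorNorm ℤ) = 0 →
          (p : ℤ) ∣ W.frobeniusTrace ℓ - G.frobeniusTrace ℓ) ∧
        (padicValNat ℓ (W.conductorNorm ℤ * G.conductorNorm ℤ) = 1 →
          (p : ℤ) ∣ W.frobeniusTrace ℓ * G.frobeniusTrace ℓ - (ℓ + 1))) :
    MissingLowerBoundAt W p :=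
  missingLowerBoundAt_rankZero_of_bcsSeed W G p hA hBCS hmodN hGZK hp hr hsurj hgen h34 hord hsurjG
    (isCongruentModP_of_prop4 W G p hKO hsurj hlist) hlev

/-- **The record shape, both halves (`MissingPPartAt W p`), strict `Σ`, congruence by Kraus–Oesterlé.**
Conditional; nothing credited. [cite: Fouquet2025EquivariantTNC, Thm 1.7 (2) (p. 7)] [cite: BurungaleCastellaSkinner2025, Thm 1.1.2 (b)]
[cite: KrausOesterle1992, Prop. 4] [cite: Miller2011LMS, Def. 1.1] -/
theorem missingPPartAt_rankZero_of_bcsSeed_of_prop4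
    (hA : Fouquet2025.padicValRat_bsd_rank_zero_of_congruence_of_seedMainIdentity)
    (hBCS : burungale_castella_skinner_charIdeal_eq_padicLFunction_integral) (hmodN : exists_isNewformOf)
    (hGZK : rank_eq_analyticRank_of_analyticRank_le_one) (hKO : KrausOesterle1992.prop4_torsionIso_of_congruences)
    (hp : 5 ≤ p) (hr : W.analyticRank = 0) (hsurj : Surj W p) (hgen : FouquetGenericAt p W)
    (h34 : Fouquet2025.Assumption34TateAt p W) (hord : GoodOrd G p) (hsurjG : Surj G p)
    (hlev : FouquetLevelCompatibleAt p W G)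
    (hlist : ∀ (ℓ : ℕ) [Fact ℓ.Prime],
      6 * ℓ < KrausOesterle1992.gammaZeroIndex (KrausOesterle1992.modulus W G) →
      (padicValNat ℓ (W.conductorNorm ℤ * G.conductorNorm ℤ) = 0 →
          (p : ℤ) ∣ W.frobeniusTrace ℓ - G.frobeniusTrace ℓ) ∧
        (padicValNat ℓ (W.conductorNorm ℤ * G.conductorNorm ℤ) = 1 →
          (p : ℤ) ∣ W.frobeniusTrace ℓ * G.frobeniusTrace ℓ - (ℓ + 1))) :
    MissingPPartAt W p :=
  missingPPartAt_rankZero_of_bcsSeed W G p hA hBCS hmodN hGZK hp hr hsurj hgen h34 hord hsurjG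
    (isCongruentModP_of_prop4 W G p hKO hsurj hlist) hlev

/-- **The record shape over the enlarged `Σ` (level-raised partner with `Assumption34TateAt p G`), congruence by
Kraus–Oesterlé.** Conditional on (A′σ) + BCS + modularity + GZK + K–O Prop. 4; nothing credited; items NOT closed.
[cite: Fouquet2025EquivariantTNC, Thm 4.1 (pp. 24–25), Ass. 3.4 (pp. 22–23)] [cite: BurungaleCastellaSkinner2025, Thm 1.1.2 (b)]
[cite: KrausOesterle1992, Prop. 4] [cite: Miller2011LMS, Def. 1.1] -/
theorem missingLowerBoundAt_rankZero_of_bcsSeedSigma_of_prop4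
    (hA : Fouquet2025.padicValRat_bsd_rank_zero_of_congruence_of_seedMainIdentity_sigma)
    (hBCS : burungale_castella_skinner_charIdeal_eq_padicLFunction_integral) (hmodN : exists_isNewformOf)
    (hGZK : rank_eq_analyticRank_of_analyticRank_le_one) (hKO : KrausOesterle1992.prop4_torsionIso_of_congruences)
    (hp : 5 ≤ p) (hr : W.analyticRank = 0) (hsurj : Surj W p) (hgen : FouquetGenericAt p W)
    (h34 : Fouquet2025.Assumption34TateAt p W) (hord : GoodOrd G p) (hsurjG : Surj G p)
    (h34G : Fouquet2025.Assumption34TateAt p G)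
    (hlist : ∀ (ℓ : ℕ) [Fact ℓ.Prime],
      6 * ℓ < KrausOesterle1992.gammaZeroIndex (KrausOesterle1992.modulus W G) →
      (padicValNat ℓ (W.conductorNorm ℤ * G.conductorNorm ℤ) = 0 →
          (p : ℤ) ∣ W.frobeniusTrace ℓ - G.frobeniusTrace ℓ) ∧
        (padicValNat ℓ (W.conductorNorm ℤ * G.conductorNorm ℤ) = 1 →
          (p : ℤ) ∣ W.frobeniusTrace ℓ * G.frobeniusTrace ℓ - (ℓ + 1))) :
    MissingLowerBoundAt W p :=
  missingLowerBoundAt_rankZero_of_bcsSeedSigma W G p hA hBCS hmodN hGZK hp hr hsurj hgen h34 hord hsurjG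
    (isCongruentModP_of_prop4 W G p hKO hsurj hlist) h34G

end Certificate

end Summit.BirchSwinnertonDyer.BirchSwinnertonDyer.Theorems

end
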